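import Mathlib
import HarnessLib
import Summits.NavierStokesRegularity.NavierStokesRegularity.Theorems.UnthreadedRigidityDoorUnthreadedRigidityVirialHornTwoChannelChannels

/-!
# Route `UnthreadedRigidityDoor`, item `UnthreadedRigidity` (W2, stmt-NavierStokesRegularity-27585) — LINE g11-1 «VIRIAL HORN»,
# BRIDGE V for PLATEAU PROFILES («TWO-CHANNEL RIGIDITY»), file 8: THE GLUING AND THE THEOREMS — `sliceLaw_of_twoChannel`, `orderTwoVirialIdentity_of_twoChannel`, `isSliceAxisymmetric_of_twoChannel`, `not_twoChannel_xyz`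

Prover file (W2 Lean hand ns-crc-p1 g10, by lineage; `--supports stmt-NavierStokesRegularity-27585 --as helper`; objects BY NAME in
`Theorems/UnthreadedRigidityDoorUnthreadedRigidityVirialHornTwoChannelDefs.lean`, p726708 / p728780 and its second append).

Content: ★ `eulerL4_eq_zero_of_channels` (where `K ≠ 0`: `s^l·ampA² = const`, `r^lα = const` by continuity, `(r^{l+1}H)′ = const`,
`H = c r^{−l} + d r^{−l−1}` locally, so `L₄H = 0`); ★ `eulerL4_eq_zero_of_vortAmpL_eq_zero` (where `K ≡ 0`: `(r^{2l+2}H′)′ = 0`,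
`H = A + B r^{−2l−1}` locally, so `L₄H = 0`); `continuousOn_eulerL4`; ★★ `profile_eq_zero_of_twoChannel`: density of the two regimes +
continuity of `L₄H` ⇒ `L₄H ≡ 0` on `(0,∞)` ⇒ kernel family ⇒ boundedness at the apex and the decay of `VirialAdmissible` leave `H ≡ 0`;
`virialMoment_eq_zero_of_profile_eq_zero`.  THE THEOREMS: ★★★ `sliceLaw_of_twoChannel` (the ORDER-TWO SLICE LAW for EVERY
virial-admissible profile, plateaus included, `l ≥ 3`, `TwoChannel l Y` — with `H ≡ 0`), ★★★ `orderTwoVirialIdentity_of_twoChannel`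
(BRIDGE V for such `(l, Y)`, all `H`, by the jet dictionary of `…ThreadingJetsSlice`), ★★★ `isSliceAxisymmetric_of_twoChannel` (the slice
rung for such `(l, Y)`), and `not_twoChannel_xyz : ¬ TwoChannel 3 (xyz)` (`|Hess(xyz)|²` is radial).
HONEST LABEL: slice-level calculus / real analysis about SPECIAL (separable) data; a piece of the L-part of ONE bridge of a RUNG line on the
wall item; `UnthreadedRigidity` (27585), W2 and NS regularity remain OPEN; nothing here is a statement about Navier–Stokes regularity.  0 kit.
-/

-- the summit and its single sub-problem share the name (CONVENTIONS §1), as in every Theorems file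
set_option linter.dupNamespace false

namespace Summit.NavierStokesRegularity.NavierStokesRegularity.Theorems.UnthreadedRigidity.VirialHorn

open scoped RealInnerProductSpace Topology Laplacian
open Filter Set MvPolynomial
open Literature.Combinatorics.LorentzianPolynomials (pderiv_pderiv_comm)
open Summit.NavierStokesRegularity.NavierStokesRegularity.Theorems.UnthreadedRigidity.ProfileHorn (E3)
open Summit.NavierStokesRegularity.NavierStokesRegularity.Theorems.UnthreadedRigidity.HornPressure (radCoeff)
open Summit.NavierStokesRegularity.NavierStokesRegularity.Theorems.PoloidalLiouville.HorizonTower hiding E3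

/-! ## §9 The local families, the gluing and the conclusion `H ≡ 0` -/

section Gluing

open scoped ContDiff
open MeasureTheory Literature.Analysis.FluidPDE

variable {l : ℕ} {P : MvPolynomial (Fin 3) ℝ} {H h : ℝ → ℝ} {C : ℝ} {x₀ : E3} {p₀ : E3 → ℝ}

/-- ★ LOCAL FAMILY WHERE `K ≠ 0`: if the two channel equations hold at every radius of an interval `(a,b) ⊆ (0,∞)` (`a > 0`), then on
that interval `H = c r^{−l} + d r^{−l−1}`, and hence `eulerL4 l H` vanishes there. -/
theorem eulerL4_eq_zero_of_channels (hl : 3 ≤ l) (hh : ContDiff ℝ ∞ h) (hHh : ∀ r : ℝ, 0 ≤ r → H r = h (r ^ 2))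
    (hC : ∀ r : ℝ, 1 ≤ r → r ^ (l + 2) * |H r| ≤ C ∧ r ^ (l + 3) * |deriv H r| ≤ C ∧ r ^ (l + 4) * |deriv (deriv H) r| ≤ C)
    {a b : ℝ} (ha : 0 < a)
    (hE1 : ∀ r ∈ Ioo a b, ampA l h (r ^ 2) ^ 2 / 2 - (2 * r ^ 2 * deriv (cascadeCoeff l h 1) (r ^ 2)
        + ((2 * l - 2 * 1 : ℕ) : ℝ) * cascadeCoeff l h 1 (r ^ 2)) = 0)
    (hE2 : ∀ r ∈ Ioo a b, 2 * r ^ 2 * deriv (cascadeCoeff l h 2) (r ^ 2)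
        + ((2 * l - 2 * 2 : ℕ) : ℝ) * cascadeCoeff l h 2 (r ^ 2) = 0)
    {r₀ : ℝ} (hr₀ : r₀ ∈ Ioo a b) : eulerL4 l H r₀ = 0 := by
  have hl1 : 1 ≤ l := by omega
  have hr₀0 : 0 < r₀ := ha.trans hr₀.1
  -- the channel equations in the variable `s` on `(a², b²)`
  have hsq : ∀ s ∈ Ioo (a ^ 2) (b ^ 2), Real.sqrt s ∈ Ioo a b ∧ Real.sqrt s ^ 2 = s := by
    intro s hs
    have hs0 : 0 ≤ s := (sq_nonneg a).trans hs.1.le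
    have hb : 0 < b := ha.trans (hr₀.1.trans hr₀.2)
    refine ⟨⟨(Real.lt_sqrt ha.le).mpr hs.1, (Real.sqrt_lt' hb).mpr hs.2⟩, Real.sq_sqrt hs0⟩
  have hE1s : ∀ s ∈ Ioo (a ^ 2) (b ^ 2), ampA l h s ^ 2 / 2 - (2 * s * deriv (cascadeCoeff l h 1) s
      + ((2 * l - 2 * 1 : ℕ) : ℝ) * cascadeCoeff l h 1 s) = 0 := by
    intro s hs
    obtain ⟨h1, h2⟩ := hsq s hs
    have := hE1 _ h1
    rwa [h2] at this
  have hE2s : ∀ s ∈ Ioo (a ^ 2) (b ^ 2), 2 * s * deriv (cascadeCoeff l h 2) s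
      + ((2 * l - 2 * 2 : ℕ) : ℝ) * cascadeCoeff l h 2 s = 0 := by
    intro s hs
    obtain ⟨h1, h2⟩ := hsq s hs
    have := hE2 _ h1
    rwa [h2] at this
  have hkey : ∀ s ∈ Ioo (a ^ 2) (b ^ 2),
      (l : ℝ) * ampA l h s ^ 2 + 2 * s * ampA l h s * (((l : ℝ) + 3) * deriv h s + 2 * s * deriv (deriv h) s) = 0 :=
    fun s hs => ampA_ode_of_channels hl hh hHh hC (sq_nonneg a) hE1s hE2s hs
  -- `ψ(s) = s^l ampA(s)²` is constant on `(a², b²)`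
  have hAd := fun s => hasDerivAt_ampA hh l s
  have hψ : ∀ s ∈ Ioo (a ^ 2) (b ^ 2), HasDerivAt (fun s : ℝ => s ^ l * ampA l h s ^ 2) 0 s := by
    intro s hs
    have h1 := (hasDerivAt_pow l s).mul ((hAd s).pow 2)
    refine h1.congr_deriv ?_
    have e : s ^ l = s ^ (l - 1) * s := (pow_sub_one_mul (by omega) s).symm
    have := hkey s hs
    rw [e]
    norm_num
    linear_combination s ^ (l - 1) * this
  have hψd : DifferentiableOn ℝ (fun s : ℝ => s ^ l * ampA l h s ^ 2) (Ioo (a ^ 2) (b ^ 2)) :=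
    fun s hs => (hψ s hs).differentiableAt.differentiableWithinAt
  obtain ⟨c, hc⟩ := isOpen_Ioo.exists_is_const_of_deriv_eq_zero isPreconnected_Ioo hψd (fun s hs => (hψ s hs).deriv)
  -- back to `r`: `(r^l α(r))² = c` on `(a,b)`, hence `r^l α(r)` is constant
  have hstrain : ∀ r ∈ Ioo a b, strainAmpL l H r = ampA l h (r ^ 2) := fun r hr => by
    rw [strainAmpL_eq_of_sq l hh hHh (ha.trans hr.1)]; rfl
  have hsqc : ∀ r ∈ Ioo a b, (r ^ l * strainAmpL l H r) ^ 2 = c := by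
    intro r hr
    have hr2 : r ^ 2 ∈ Ioo (a ^ 2) (b ^ 2) :=
      ⟨by nlinarith [hr.1, ha], by nlinarith [hr.1, hr.2, ha]⟩
    rw [hstrain r hr, ← hc (r ^ 2) hr2]
    ring
  have hcont : ContinuousOn (fun r : ℝ => r ^ l * strainAmpL l H r) (Ioo a b) := by
    have hc' : Continuous fun r : ℝ => r ^ l * ampA l h (r ^ 2) :=
      (continuous_pow l).mul ((contDiff_ampA hh l).continuous.comp (continuous_pow 2))
    exact hc'.continuousOn.congr fun r hr => by simp only [hstrain r hr]
  obtain ⟨c', hc'⟩ := exists_const_of_sq_const hcont hsqc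
  -- `(r^{l+1} H)' = r^l α = c'` on `(a,b)` ⇒ `r^{l+1} H = c' r + d`
  have hHc : ContDiffOn ℝ ∞ H (Ioi 0) := contDiffOn_profile_Ioi hh hHh
  have hf : ∀ r ∈ Ioo a b, HasDerivAt (fun x : ℝ => x ^ (l + 1) * H x) (c') r := by
    intro r hr
    have hr0 : 0 < r := ha.trans hr.1
    have h1 := hasDerivAt_pow_mul hHc (l + 1) hr0
    refine h1.congr_deriv ?_
    rw [← hc' r hr, Nat.add_sub_cancel]
    unfold strainAmpL
    push_cast
    ring
  have hfd : DifferentiableOn ℝ (fun x : ℝ => x ^ (l + 1) * H x) (Ioo a b) :=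
    fun r hr => (hf r hr).differentiableAt.differentiableWithinAt
  have hgd : DifferentiableOn ℝ (fun x : ℝ => c' * x) (Ioo a b) := ((differentiable_const _).mul differentiable_id).differentiableOn
  obtain ⟨d, hd⟩ := isOpen_Ioo.exists_eq_add_of_deriv_eq isPreconnected_Ioo hfd hgd (fun r hr => by
    rw [(hf r hr).deriv]
    rw [deriv_const_mul _ differentiableAt_id, deriv_id'', mul_one])
  -- the local closed form and `L₄`
  have hloc : H =ᶠ[𝓝 r₀] fun r => c' * r ^ (-(l : ℤ)) + d * r ^ (-((l : ℤ) + 1)) := by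
    filter_upwards [Ioo_mem_nhds hr₀.1 hr₀.2] with r hr
    have hr0 : r ≠ 0 := ne_of_gt (ha.trans hr.1)
    have h := hd hr
    simp only at h
    have e1 : r ^ (-(l : ℤ)) = (r ^ l)⁻¹ := by rw [zpow_neg, zpow_natCast]
    have e2 : r ^ (-((l : ℤ) + 1)) = (r ^ (l + 1))⁻¹ := by
      rw [zpow_neg, show ((l : ℤ) + 1) = ((l + 1 : ℕ) : ℤ) by push_cast; ring, zpow_natCast]
    rw [e1, e2]
    have hpl : r ^ (l + 1) ≠ 0 := pow_ne_zero _ hr0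
    have hpl' : r ^ l ≠ 0 := pow_ne_zero _ hr0
    apply mul_left_cancel₀ hpl
    rw [h, pow_succ]
    field_simp
  refine eulerL4_eq_zero_of_eventuallyEq l hr₀0.ne' hloc ?_ ?_
  · push_cast; ring
  · push_cast; ring

/-- ★ LOCAL FAMILY WHERE `K ≡ 0`: if the vorticity amplitude vanishes on an interval `(a,b) ⊆ (0,∞)` then `H = A + B r^{−2l−1}` there,
and hence `eulerL4 l H` vanishes there. -/
theorem eulerL4_eq_zero_of_vortAmpL_eq_zero (hl : 1 ≤ l) (hh : ContDiff ℝ ∞ h) (hHh : ∀ r : ℝ, 0 ≤ r → H r = h (r ^ 2))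
    {a b : ℝ} (ha : 0 < a) (hK : ∀ r ∈ Ioo a b, vortAmpL l H r = 0) {r₀ : ℝ} (hr₀ : r₀ ∈ Ioo a b) :
    eulerL4 l H r₀ = 0 := by
  have hr₀0 : 0 < r₀ := ha.trans hr₀.1
  have hHc : ContDiffOn ℝ ∞ H (Ioi 0) := contDiffOn_profile_Ioi hh hHh
  have hH'c : ContDiffOn ℝ ∞ (deriv H) (Ioi 0) := hHc.deriv_of_isOpen isOpen_Ioi (by simp)
  -- `(r^{2l+2} H')' = r^{2l+1} (r H'' + (2l+2) H') = r^{2l+2} K = 0`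
  have hf : ∀ r ∈ Ioo a b, HasDerivAt (fun x : ℝ => x ^ (2 * l + 2) * deriv H x) 0 r := by
    intro r hr
    have hr0 : 0 < r := ha.trans hr.1
    have h1 := hasDerivAt_pow_mul hH'c (2 * l + 2) hr0
    rw [show 2 * l + 2 - 1 = 2 * l + 1 by omega] at h1
    refine h1.congr_deriv ?_
    have hKr := hK r hr
    unfold vortAmpL at hKr
    have hr0' : r ≠ 0 := hr0.ne'
    have hKr' : r * deriv (deriv H) r + 2 * ((l : ℝ) + 1) * deriv H r = 0 := by
      have hh2 := hKr
      field_simp at hh2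
      linear_combination hh2
    have e : r ^ (2 * l + 2) = r ^ (2 * l + 1) * r := pow_succ r (2 * l + 1)
    rw [e]
    push_cast
    linear_combination r ^ (2 * l + 1) * hKr'
  have hfd : DifferentiableOn ℝ (fun x : ℝ => x ^ (2 * l + 2) * deriv H x) (Ioo a b) :=
    fun r hr => (hf r hr).differentiableAt.differentiableWithinAt
  obtain ⟨k, hk⟩ := isOpen_Ioo.exists_is_const_of_deriv_eq_zero isPreconnected_Ioo hfd (fun r hr => (hf r hr).deriv)
  -- `H' = k r^{−2l−2}` ⇒ `H = A − k/(2l+1) r^{−2l−1}`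
  have hHd : DifferentiableOn ℝ H (Ioo a b) := (hHc.differentiableOn (by simp)).mono fun r hr => ha.trans hr.1
  set g : ℝ → ℝ := fun r => (-k / (2 * l + 1)) * r ^ (-((2 * l + 1 : ℕ) : ℤ)) with hg
  have hgder : ∀ r ∈ Ioo a b, HasDerivAt g (k * (r ^ (2 * l + 2))⁻¹) r := by
    intro r hr
    have hr0 : r ≠ 0 := ne_of_gt (ha.trans hr.1)
    have h1 := (hasDerivAt_zpow (-((2 * l + 1 : ℕ) : ℤ)) r (Or.inl hr0)).const_mul (-k / (2 * l + 1))
    refine h1.congr_deriv ?_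
    have e : r ^ (-((2 * l + 1 : ℕ) : ℤ) - 1) = (r ^ (2 * l + 2))⁻¹ := by
      rw [show (-((2 * l + 1 : ℕ) : ℤ) - 1) = -((2 * l + 2 : ℕ) : ℤ) by push_cast; ring, zpow_neg, zpow_natCast]
    rw [e]
    have h2l1 : (2 * (l : ℝ) + 1) ≠ 0 := by positivity
    push_cast
    field_simp
  have hgd : DifferentiableOn ℝ g (Ioo a b) := fun r hr => (hgder r hr).differentiableAt.differentiableWithinAt
  obtain ⟨A, hA⟩ := isOpen_Ioo.exists_eq_add_of_deriv_eq isPreconnected_Ioo hHd hgd (fun r hr => by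
    rw [(hgder r hr).deriv]
    have hr0 : r ≠ 0 := ne_of_gt (ha.trans hr.1)
    have h := hk r hr
    have hpow : r ^ (2 * l + 2) ≠ 0 := pow_ne_zero _ hr0
    field_simp
    linear_combination h)
  have hloc : H =ᶠ[𝓝 r₀] fun r => A * r ^ (0 : ℤ) + (-k / (2 * l + 1)) * r ^ (-((2 * l + 1 : ℕ) : ℤ)) := by
    filter_upwards [Ioo_mem_nhds hr₀.1 hr₀.2] with r hr
    rw [hA hr, zpow_zero, mul_one, add_comm]
  refine eulerL4_eq_zero_of_eventuallyEq l hr₀0.ne' hloc ?_ ?_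
  · push_cast; ring
  · push_cast; ring

/-- `eulerL4 l H` is continuous on `(0,∞)` for a profile smooth there. -/
theorem continuousOn_eulerL4 (l : ℕ) (hH : ContDiffOn ℝ ∞ H (Ioi 0)) : ContinuousOn (eulerL4 l H) (Ioi 0) := by
  unfold eulerL4
  exact (contDiffOn_eulerOp (contDiffOn_eulerOp (contDiffOn_eulerOp (contDiffOn_eulerOp hH _) _) _) _).continuousOn

/-- ★★ THE PROFILE VANISHES.  Under the hypotheses of the slice law in degree `l ≥ 3` with `TwoChannel l Y`, the profile is identically
zero on `[0,∞)`: the channel equations give `L₄H = 0` where `K ≠ 0`, irrotationality gives it where `K ≡ 0`, continuity glues, and the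
kernel of `L₄` meets boundedness at the apex and the decay only in `0`. -/
theorem profile_eq_zero_of_twoChannel (hl : 3 ≤ l) (hP : P.IsHomogeneous l) (hlap : Zonal.lapP P = 0)
    (h2 : TwoChannel l (Zonal.evalE P)) (hH : VirialAdmissible l H)
    (hsm : ContDiff ℝ (⊤ : ℕ∞) (sepShellL H (Zonal.evalE P) x₀))
    (hdiv : VectorCalculus.IsDivFree (sepShellL H (Zonal.evalE P) x₀))
    (hp : ContDiff ℝ (⊤ : ℕ∞) p₀)
    (hpoi : ∀ x : E3, (Δ p₀) x =
      -VectorCalculus.divergence (convect (sepShellL H (Zonal.evalE P) x₀) (sepShellL H (Zonal.evalE P) x₀)) x)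
    (hdec : Tendsto p₀ (cocompact E3) (𝓝 0))
    (hj : ∀ x : E3, ThreadingJets.fluxJetTwo (sepShellL H (Zonal.evalE P) x₀) p₀ x₀ x = 0) :
    ∀ r : ℝ, 0 ≤ r → H r = 0 := by
  have hl1 : 1 ≤ l := by omega
  obtain ⟨⟨h, hh, hHh⟩, C, hC⟩ := hH
  have hHc : ContDiffOn ℝ ∞ H (Ioi 0) := contDiffOn_profile_Ioi hh hHh
  have hKc := continuousOn_vortAmpL l hh hHh
  have hLc := continuousOn_eulerL4 l hHc
  -- `L₄ H = 0` at every radius with `K ≠ 0`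
  have hS : ∀ r : ℝ, 0 < r → vortAmpL l H r ≠ 0 → eulerL4 l H r = 0 := by
    intro r hr hK
    have hev : ∀ᶠ x in 𝓝 r, vortAmpL l H x ≠ 0 ∧ 0 < x :=
      ((hKc.continuousAt (Ioi_mem_nhds hr)).eventually_ne hK).and (Ioi_mem_nhds hr)
    obtain ⟨a', b, hab, hsub⟩ := mem_nhds_iff_exists_Ioo_subset.mp hev
    set a := max a' (r / 2) with ha_def
    have ha : 0 < a := lt_max_of_lt_right (by linarith)
    have hra : r ∈ Ioo a b := ⟨max_lt hab.1 (by linarith), hab.2⟩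
    have hsub' : Ioo a b ⊆ Ioo a' b := Ioo_subset_Ioo (le_max_left _ _) le_rfl
    refine eulerL4_eq_zero_of_channels hl hh hHh hC ha (fun x hx => ?_) (fun x hx => ?_) hra
    · have := hsub (hsub' hx)
      exact (twoChannel_euler_eqs hl hP hlap h2 ⟨⟨h, hh, hHh⟩, C, hC⟩ hh hHh hC hsm hdiv hp hpoi hdec hj this.2 this.1).1
    · have := hsub (hsub' hx)
      exact (twoChannel_euler_eqs hl hP hlap h2 ⟨⟨h, hh, hHh⟩, C, hC⟩ hh hHh hC hsm hdiv hp hpoi hdec hj this.2 this.1).2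
  -- `L₄ H = 0` everywhere on `(0,∞)` by density and continuity
  have hL : ∀ r : ℝ, 0 < r → eulerL4 l H r = 0 := by
    intro r hr
    by_contra hne
    have hev : ∀ᶠ x in 𝓝 r, eulerL4 l H x ≠ 0 ∧ 0 < x :=
      ((hLc.continuousAt (Ioi_mem_nhds hr)).eventually_ne hne).and (Ioi_mem_nhds hr)
    obtain ⟨a', b, hab, hsub⟩ := mem_nhds_iff_exists_Ioo_subset.mp hev
    set a := max a' (r / 2) with ha_def
    have ha : 0 < a := lt_max_of_lt_right (by linarith)
    have hra : r ∈ Ioo a b := ⟨max_lt hab.1 (by linarith), hab.2⟩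
    have hsub' : Ioo a b ⊆ Ioo a' b := Ioo_subset_Ioo (le_max_left _ _) le_rfl
    by_cases hT : ∀ x ∈ Ioo a b, vortAmpL l H x = 0
    · exact (hsub (hsub' hra)).1 (eulerL4_eq_zero_of_vortAmpL_eq_zero hl1 hh hHh ha hT hra)
    · push Not at hT
      obtain ⟨x, hx, hKx⟩ := hT
      exact (hsub (hsub' hx)).1 (hS x (hsub (hsub' hx)).2 hKx)
  -- the kernel of `L₄`, boundedness at the apex, decay
  obtain ⟨A, B, Cc, D, hfam⟩ := exists_family_of_eulerL4_eq_zero hl1 hHc hL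
  obtain ⟨M, hM⟩ := isCompact_Icc.exists_bound_of_continuousOn (hh.continuous.continuousOn (s := Icc (0:ℝ) 1))
  have hbd : ∀ r : ℝ, 0 < r → r ≤ 1 → |H r| ≤ M := by
    intro r hr hr1
    rw [hHh r hr.le]
    have := hM (r ^ 2) ⟨sq_nonneg r, by nlinarith⟩
    simpa [Real.norm_eq_abs] using this
  obtain ⟨hB, hCc, hD⟩ := family_coeff_eq_zero_of_bounded hl1 hfam hbd
  have hHA : ∀ r : ℝ, 0 < r → H r = A := by
    intro r hr; rw [hfam r hr, hB, hCc, hD]; ring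
  have hA : A = 0 := const_eq_zero_of_virial_decay (Cd := C) l fun r hr => by
    rw [← hHA r (by linarith)]; exact (hC r hr).1
  have hpos : ∀ r : ℝ, 0 < r → H r = 0 := fun r hr => by rw [hHA r hr, hA]
  -- the apex by continuity of `h`
  intro r hr
  rcases hr.eq_or_lt with h0 | hpos'
  · rw [← h0, hHh 0 le_rfl]
    have hlim : Tendsto (fun s : ℝ => h (s ^ 2)) (𝓝[>] 0) (𝓝 (h (0 ^ 2))) :=
      ((hh.continuous.comp (continuous_pow 2)).tendsto 0).mono_left nhdsWithin_le_nhds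
    have hzero : Tendsto (fun s : ℝ => h (s ^ 2)) (𝓝[>] 0) (𝓝 0) := by
      refine tendsto_const_nhds.congr' ?_
      filter_upwards [self_mem_nhdsWithin] with s hs
      rw [← hHh s (le_of_lt hs), hpos s hs]
    simpa using tendsto_nhds_unique hlim hzero
  · exact hpos r hpos'

/-- a null profile has zero virial moment. -/
theorem virialMoment_eq_zero_of_profile_eq_zero (l : ℕ) (hH0 : ∀ r : ℝ, 0 ≤ r → H r = 0) : virialMoment l H = 0 := by
  have h0 : ∀ r : ℝ, 0 < r → strainAmpL l H r = 0 := by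
    intro r hr
    have hev : H =ᶠ[𝓝 r] fun _ => (0 : ℝ) := by
      filter_upwards [Ioi_mem_nhds hr] with x hx using hH0 x (le_of_lt hx)
    unfold strainAmpL
    rw [hev.deriv_eq, deriv_const, hH0 r hr.le]
    ring
  unfold virialMoment
  rw [setIntegral_congr_fun measurableSet_Ioi (fun r hr => by rw [h0 r hr])]
  simp

end Gluing

/-! ## §10 THE THEOREMS: slice law, bridge V and the slice rung for two-channel harmonics; the failure at `xyz` -/

section Main

open scoped ContDiff
open MeasureTheory Literature.Analysis.FluidPDE
open Summit.NavierStokesRegularity.NavierStokesRegularity.Theorems.UnthreadedRigidity.ProfileHorn (IsSliceAxisymmetric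
  isSliceAxisymmetric_of_eq_zero)
open Summit.NavierStokesRegularity.NavierStokesRegularity.Theorems.UnthreadedRigidity.ThreadingJets
  (fluxJetTwo laplacian_pressure_eq_Ico iteratedDerivWithin_two_threadingFlux_Ici_eq_fluxJetTwo)

/-- ★★★ THE ORDER-TWO SLICE LAW FOR EVERY PROFILE, PLATEAUS INCLUDED (degree `l ≥ 3`, two-channel harmonic `Y`): the body of
`ThreadingJets.OrderTwoSliceLaw` — and in fact the profile itself vanishes (`profile_eq_zero_of_twoChannel`). -/
theorem sliceLaw_of_twoChannel (l : ℕ) (x₀ : E3) (Y : E3 → ℝ) (H : ℝ → ℝ) (p₀ : E3 → ℝ)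
    (hl : 3 ≤ l) (hY : IsSolidHarmonic l Y) (h2 : TwoChannel l Y) (hH : VirialAdmissible l H)
    (hsm : ContDiff ℝ (⊤ : ℕ∞) (sepShellL H Y x₀)) (hdiv : VectorCalculus.IsDivFree (sepShellL H Y x₀))
    (hp : ContDiff ℝ (⊤ : ℕ∞) p₀)
    (hpoi : ∀ x : E3, (Δ p₀) x = -VectorCalculus.divergence (convect (sepShellL H Y x₀) (sepShellL H Y x₀)) x)
    (hdec : Tendsto p₀ (cocompact E3) (𝓝 0)) (hj : ∀ x : E3, fluxJetTwo (sepShellL H Y x₀) p₀ x₀ x = 0) :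
    (∀ r : ℝ, 0 ≤ r → H r = 0) ∧ ∀ ξ : E3, virialMoment l H * angForm Y ξ = 0 := by
  obtain ⟨P, hP, hlap, rfl⟩ := hY.exists_evalE
  have hH0 := profile_eq_zero_of_twoChannel hl hP hlap h2 hH hsm hdiv hp hpoi hdec hj
  exact ⟨hH0, fun ξ => by rw [virialMoment_eq_zero_of_profile_eq_zero l hH0, zero_mul]⟩

/-- ★★★ BRIDGE V `VirialHorn.OrderTwoVirialIdentity` FOR EVERY PROFILE, PLATEAUS INCLUDED, in every degree `l ≥ 3`, for every
two-channel solid harmonic `Y`: a classical Navier–Stokes solution on `[t₀, T)` with decaying pressure, issued from the separable shell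
`sepShellL H Y x₀`, whose threading flux is order-two silent at `t₀`, has `virialMoment l H · angForm Y ≡ 0` — indeed `H ≡ 0`.
(Jet dictionary of `…ThreadingJetsSlice`; compare `orderTwoVirialIdentity_of_dichotomy`, which needs NO plateau instead of `TwoChannel`.) -/
theorem orderTwoVirialIdentity_of_twoChannel (l : ℕ) (t₀ T : ℝ) (u : ℝ → E3 → E3) (p : ℝ → E3 → ℝ) (x₀ : E3) (Y : E3 → ℝ)
    (H : ℝ → ℝ) (hl : 3 ≤ l) (hT : t₀ < T) (h : IsClassicalNSSolutionOn (Set.Ico t₀ T) 1 0 u p)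
    (hp : ∀ t ∈ Set.Ico t₀ T, Tendsto (p t) (cocompact E3) (𝓝 0))
    (hY : IsSolidHarmonic l Y) (h2 : TwoChannel l Y) (hH : VirialAdmissible l H) (hu0 : u t₀ = sepShellL H Y x₀)
    (hjet : ∀ x : E3, iteratedDerivWithin 2 (fun t => ProfileHorn.threadingFlux u x₀ t x) (Set.Ici t₀) t₀ = 0) :
    (∀ r : ℝ, 0 ≤ r → H r = 0) ∧ ∀ ξ : E3, virialMoment l H * angForm Y ξ = 0 := by
  have ht₀ : t₀ ∈ Ico t₀ T := ⟨le_rfl, hT⟩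
  have hsm : ContDiff ℝ ∞ (sepShellL H Y x₀) := by rw [← hu0]; exact h.contDiff_velocity ht₀
  have hdiv : VectorCalculus.IsDivFree (sepShellL H Y x₀) := by rw [← hu0]; exact h.divFree t₀ ht₀
  have hps : ContDiff ℝ ∞ (p t₀) := h.contDiff_pressure ht₀
  have hpoi : ∀ x : E3, (Δ (p t₀)) x =
      -VectorCalculus.divergence (convect (sepShellL H Y x₀) (sepShellL H Y x₀)) x := by
    intro x
    rw [← hu0]
    exact laplacian_pressure_eq_Ico h hT ht₀ x
  have hj : ∀ x : E3, fluxJetTwo (sepShellL H Y x₀) (p t₀) x₀ x = 0 := by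
    intro x
    rw [← hu0, ← iteratedDerivWithin_two_threadingFlux_Ici_eq_fluxJetTwo h hT]
    exact hjet x
  exact sliceLaw_of_twoChannel l x₀ Y H (p t₀) hl hY h2 hH hsm hdiv hps hpoi (hp t₀ ht₀) hj

/-- ★★★ THE SEPARABLE SLICE RUNG `VirialHorn.SeparableOrderTwoRigidityL` FOR EVERY PROFILE in degree `l ≥ 3`, two-channel `Y`: the
slice is axisymmetric (it is the zero field). -/
theorem isSliceAxisymmetric_of_twoChannel (l : ℕ) (t₀ T : ℝ) (u : ℝ → E3 → E3) (p : ℝ → E3 → ℝ) (x₀ : E3) (Y : E3 → ℝ)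
    (H : ℝ → ℝ) (hl : 3 ≤ l) (hT : t₀ < T) (h : IsClassicalNSSolutionOn (Set.Ico t₀ T) 1 0 u p)
    (hp : ∀ t ∈ Set.Ico t₀ T, Tendsto (p t) (cocompact E3) (𝓝 0))
    (hY : IsSolidHarmonic l Y) (h2 : TwoChannel l Y) (hH : VirialAdmissible l H) (hu0 : u t₀ = sepShellL H Y x₀)
    (hjet : ∀ x : E3, iteratedDerivWithin 2 (fun t => ProfileHorn.threadingFlux u x₀ t x) (Set.Ici t₀) t₀ = 0) :
    IsSliceAxisymmetric (u t₀) x₀ := by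
  have hH0 := (orderTwoVirialIdentity_of_twoChannel l t₀ T u p x₀ Y H hl hT h hp hY h2 hH hu0 hjet).1
  apply isSliceAxisymmetric_of_eq_zero
  intro x
  rw [hu0]
  exact sepShellL_null H Y x₀ hH0 x

/-- THE RESIDUE OF R1: the polyhedral harmonic `xyz` is NOT two-channel (`|Hess(xyz)|² = 2|y|²` is radial, so `{Y, Δ²(Y²)} ≡ 0`
and `θ = δ₂` is a vanishing combination with `θ₂ ≠ 0`). -/
theorem not_twoChannel_xyz : ¬ TwoChannel 3 (Zonal.evalE (X 0 * X 1 * X 2 : MvPolynomial (Fin 3) ℝ)) := by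
  set P : MvPolynomial (Fin 3) ℝ := X 0 * X 1 * X 2 with hPdef
  intro h2
  have hlap : Zonal.lapP P = 0 := by
    simp [hPdef, Zonal.lapP]
  -- `F₂ = 4·hessSqP = 8 (X0² + X1² + X2²)`
  have hF2 : sqLapP P 2 = C 8 * (X 0 * X 0 + X 1 * X 1 + X 2 * X 2) := by
    rw [sqLapP_two hlap, map_ofNat C 8]
    simp only [hessSqP, Fin.sum_univ_three, hPdef, MvPolynomial.pderiv_mul]
    simp
    ring
  -- its bracket with `P` vanishes: `det[y, ∇P, 16 y] = 0`
  have hbr : ∀ y : E3, pbr (Zonal.evalE P) (sqLapF (Zonal.evalE P) 2) y = 0 := by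
    intro y
    rw [pbr_sqLapF_evalE, hF2]
    simp [Zonal.detP, Zonal.evalE, hPdef]
    ring
  have key := h2 (fun k => if k = 2 then 1 else 0) fun y _ => by
    rw [Finset.sum_eq_single 2 (fun k _ hk => by simp [hk]) (by simp)]
    simp [hbr y]
  simp at key

end Main

end Summit.NavierStokesRegularity.NavierStokesRegularity.Theorems.UnthreadedRigidity.VirialHorn
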